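import Summits.ResolutionOfSingularities.ResolutionOfSingularities.Theorems.FrobeniusClosingPatchingRelPerfectConeMemberLevelTwoIdeals
import HarnessLib

/-!
# Crux `PatchingRelPerfect` (stmt-ResolutionOfSingularities-16161), chain w52 — CORE RUNG r2pt,
# part 2c: the vertex blow-up `Bl_{z₀}`, abstractly — regularity

[OURS · L1 W5.2 · rung] Continues `…ConeMemberLevelTwoIdeals.lean` (over any ring: on the
`v_k`-chart `C_j` of the blowing up of `c = (t, v₀, v₁, v₂)` one has
`(𝔨 𝔴) C_j = w² · (u', w G) · (w, u')`, and `(w²)` on the `t`-chart).  Here `A` is regular, `c` is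
quasi-regular with `A/(c)` a regular domain, and the cone `V(t, F)`, `F = v₀v₁ + v₂²`, is regular
at the primes missing some `v_k`.  PROVED:

* the hypotheses of the last step (`…ConeMemberLevelThree.lean`) on the `v_k`-charts: `(w, u')`
  quasi-regular with regular quotient (`PointBlowupChartIterate`); the conic `Ḡ` (`T₂ + T₃²`,
  `T₁ + T₃²`, `T₁T₂ + 1` — `exists_conic`, via `chartStageEquiv`) gives `G` a non-zero-divisor
  modulo `(w, u')` (`mk_G_mem_nonZeroDivisors`) and `C_j/(w, u', G)` regular
  (`isRegularRing_quot_cthree_sup_G`, Jacobian); `C_j/(u', G)` is regular off `V(w)` by transport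
  from `A/(t, F)` through `C_j[1/w] = A[1/v_k]` (`isRegularLocalRing_quot_span_u'_G`);
* `isRegular_of_isBlowup_kw_succ`, `isRegular_of_isBlowup_kw_zero`, and the level-two theorem
  `isRegular_of_isBlowup_kw_mul_span` — **every blowing up of `Spec A` along
  `(𝔨 𝔴) · (t, v₀, v₁, v₂)` is regular** (chartwise assembly twice, Stacks 080A; Liu 8.1.19 (a)).

Nothing here is a statement of the manuscript under review.

## References

* The Stacks Project, Tags 080A, 080B, 0804, 07Z3, 0BIQ. [StacksProject]
* Q. Liu, *Algebraic Geometry and Arithmetic Curves*, OUP 2002, Thm. 8.1.19 (a). [Liu2002]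
* H. Matsumura, *Commutative Ring Theory*, CUP 1986, Thms. 14.2, 16.2. [Matsumura1987]
-/

-- `Summit.<Summit>.<Sub>.Theorems` with `Sub = Summit` (single-conjunct summit, D-0017)
set_option linter.dupNamespace false

noncomputable section

open CategoryTheory CategoryTheory.Limits AlgebraicGeometry Literature.AlgebraicGeometry.Resolution
open IsLocalRing

namespace Summit.ResolutionOfSingularities.ResolutionOfSingularities.Theorems

namespace ConeRung

universe u

/-! ## Level two over a regular base: the hypotheses of the last step on the `v_k`-charts -/

section Regular

variable {A : Type u} [CommRing A] (t : A) (v : Fin 3 → A)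
  (hc : IsQuasiRegular (Fin.cons t v : Fin 4 → A))

local notation3 "cc" => (Fin.cons t v : Fin 4 → A)
local notation3 "F" => v 0 * v 1 + v 2 ^ 2
/-- the `v_k`-chart (`j = k + 1`) and its data -/
local notation3 "w[" k "]" => chartBase cc (Fin.succ k) (cc (Fin.succ k))
local notation3 "u'[" k "]" => chartGen cc (Fin.succ k) 0
local notation3 "G[" k "]" => chartGen cc (Fin.succ k) 1 * chartGen cc (Fin.succ k) 2 +
  chartGen cc (Fin.succ k) 3 ^ 2
/-- the next centre `(w, u')` -/
local notation3 "c₃[" k "]" => (Fin.cons (chartBase cc (Fin.succ k) (cc (Fin.succ k)))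
  (fun _ : Fin 1 => chartGen cc (Fin.succ k) 0) : Fin 2 → chartRing cc (Fin.succ k))
/-- the stage data: coefficient ring and variables of `C ⧸ (w, u')` -/
local notation3 "Λ" => A ⧸ (Ideal.span (Set.range cc) ⊔ ⊥)
local notation3 "σ[" k "]" => {m : Fin 4 // m ≠ Fin.succ k ∧ m ∉ ({0} : Set (Fin 4))}
local notation3 "ε[" k "]" => chartStageEquiv cc (Fin.succ k) ⊥ {0} hc (succ_notMem_zero k)

/-- The stage ideal `(w) + 0 + (u')` is the ideal of the next centre `(w, u')`. [folklore] -/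
theorem chartStageIdeal_two_eq (k : Fin 3) :
    chartStageIdeal cc (Fin.succ k) ⊥ {0} = Ideal.span (Set.range c₃[k]) := by
  rw [chartStageIdeal, Ideal.map_bot, sup_bot_eq, Set.image_singleton, span_range_cthree,
    Ideal.span_insert]

include hc in
/-- `(w, u')` is quasi-regular on the chart (`PointBlowupChartIterate`).
[cite: Matsumura1987, Thm. 16.2] -/
theorem isQuasiRegular_cthree (k : Fin 3) : IsQuasiRegular c₃[k] :=
  isQuasiRegular_cons_chartGen cc (Fin.succ k)
    (fun _ : Fin 1 => (⟨0, (Fin.succ_ne_zero k).symm⟩ : {l : Fin 4 // l ≠ Fin.succ k})) hc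
    (Function.injective_of_subsingleton _)

include hc in
/-- `C ⧸ (w, u')` is a regular ring when `A ⧸ (c)` is. [cite: StacksProject, Tag 0BIQ] -/
theorem isRegularRing_quot_cthree (k : Fin 3) [IsRegularRing (A ⧸ Ideal.span (Set.range cc))] :
    IsRegularRing (chartRing cc (Fin.succ k) ⧸ Ideal.span (Set.range c₃[k])) :=
  isRegularRing_quot_cons_chartGen cc (Fin.succ k)
    (fun _ : Fin 1 => (⟨0, (Fin.succ_ne_zero k).symm⟩ : {l : Fin 4 // l ≠ Fin.succ k})) hc

/-! ### The conics `Ḡ` chart by chart: `T₂ + T₃²`, `T₁ + T₃²`, `T₁T₂ + 1` -/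

include hc in
/-- Chart `v₀`: `Ḡ = T₂ + T₃²`. [folklore] -/
theorem exists_conic_zero [Nontrivial Λ] :
    ∃ (Gb : MvPolynomial σ[(0 : Fin 3)] Λ) (m : σ[(0 : Fin 3)]),
      ε[(0 : Fin 3)] Gb = Ideal.Quotient.mk _ G[(0 : Fin 3)] ∧ MvPolynomial.pderiv m Gb ≠ 0 ∧
      ∀ (Q : Ideal (MvPolynomial σ[(0 : Fin 3)] Λ)), Q.IsPrime → Gb ∈ Q →
        ∃ m', MvPolynomial.pderiv m' Gb ∉ Q := by
  have n21 : (2 : Fin 4) ≠ Fin.succ (0 : Fin 3) := two_ne_one4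
  have n31 : (3 : Fin 4) ≠ Fin.succ (0 : Fin 3) := three_ne_one4
  refine ⟨MvPolynomial.X ⟨2, ne_and_notMem_zero n21 two_ne_zero4⟩ +
    MvPolynomial.X ⟨3, ne_and_notMem_zero n31 three_ne_zero4⟩ ^ 2,
    ⟨2, ne_and_notMem_zero n21 two_ne_zero4⟩, ?_, ?_, ?_⟩
  · have hGeq : G[(0 : Fin 3)] =
        chartGen cc (Fin.succ (0 : Fin 3)) 2 + chartGen cc (Fin.succ (0 : Fin 3)) 3 ^ 2 := by
      rw [show chartGen cc (Fin.succ (0 : Fin 3)) 1 = 1 from chartGen_self cc _]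
      ring
    rw [map_add, map_pow, chartStageEquiv_X, chartStageEquiv_X, hGeq, map_add, map_pow]
  · rw [map_add, MvPolynomial.pderiv_X_self, MvPolynomial.pderiv_pow,
      MvPolynomial.pderiv_X_of_ne (fun h => two_ne_three4 (congrArg Subtype.val h).symm),
      mul_zero, add_zero]
    exact one_ne_zero
  · intro Q hQ _
    refine ⟨⟨2, ne_and_notMem_zero n21 two_ne_zero4⟩, ?_⟩
    rw [map_add, MvPolynomial.pderiv_X_self, MvPolynomial.pderiv_pow,
      MvPolynomial.pderiv_X_of_ne (fun h => two_ne_three4 (congrArg Subtype.val h).symm),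
      mul_zero, add_zero]
    exact Q.ne_top_iff_one.mp hQ.ne_top

include hc in
/-- Chart `v₁`: `Ḡ = T₁ + T₃²`. [folklore] -/
theorem exists_conic_one [Nontrivial Λ] :
    ∃ (Gb : MvPolynomial σ[(1 : Fin 3)] Λ) (m : σ[(1 : Fin 3)]),
      ε[(1 : Fin 3)] Gb = Ideal.Quotient.mk _ G[(1 : Fin 3)] ∧ MvPolynomial.pderiv m Gb ≠ 0 ∧
      ∀ (Q : Ideal (MvPolynomial σ[(1 : Fin 3)] Λ)), Q.IsPrime → Gb ∈ Q →
        ∃ m', MvPolynomial.pderiv m' Gb ∉ Q := by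
  have n12 : (1 : Fin 4) ≠ Fin.succ (1 : Fin 3) := one_ne_two4
  have n32 : (3 : Fin 4) ≠ Fin.succ (1 : Fin 3) := three_ne_two4
  refine ⟨MvPolynomial.X ⟨1, ne_and_notMem_zero n12 one_ne_zero4⟩ +
    MvPolynomial.X ⟨3, ne_and_notMem_zero n32 three_ne_zero4⟩ ^ 2,
    ⟨1, ne_and_notMem_zero n12 one_ne_zero4⟩, ?_, ?_, ?_⟩
  · have hGeq : G[(1 : Fin 3)] =
        chartGen cc (Fin.succ (1 : Fin 3)) 1 + chartGen cc (Fin.succ (1 : Fin 3)) 3 ^ 2 := by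
      rw [show chartGen cc (Fin.succ (1 : Fin 3)) 2 = 1 from chartGen_self cc _]
      ring
    rw [map_add, map_pow, chartStageEquiv_X, chartStageEquiv_X, hGeq, map_add, map_pow]
  · rw [map_add, MvPolynomial.pderiv_X_self, MvPolynomial.pderiv_pow,
      MvPolynomial.pderiv_X_of_ne (fun h => one_ne_three4 (congrArg Subtype.val h).symm),
      mul_zero, add_zero]
    exact one_ne_zero
  · intro Q hQ _
    refine ⟨⟨1, ne_and_notMem_zero n12 one_ne_zero4⟩, ?_⟩
    rw [map_add, MvPolynomial.pderiv_X_self, MvPolynomial.pderiv_pow,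
      MvPolynomial.pderiv_X_of_ne (fun h => one_ne_three4 (congrArg Subtype.val h).symm),
      mul_zero, add_zero]
    exact Q.ne_top_iff_one.mp hQ.ne_top

include hc in
/-- Chart `v₂`: `Ḡ = T₁T₂ + 1` (`∂Ḡ/∂T₁ = T₂` is a unit modulo `Ḡ`). [folklore] -/
theorem exists_conic_two [Nontrivial Λ] :
    ∃ (Gb : MvPolynomial σ[(2 : Fin 3)] Λ) (m : σ[(2 : Fin 3)]),
      ε[(2 : Fin 3)] Gb = Ideal.Quotient.mk _ G[(2 : Fin 3)] ∧ MvPolynomial.pderiv m Gb ≠ 0 ∧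
      ∀ (Q : Ideal (MvPolynomial σ[(2 : Fin 3)] Λ)), Q.IsPrime → Gb ∈ Q →
        ∃ m', MvPolynomial.pderiv m' Gb ∉ Q := by
  have n13 : (1 : Fin 4) ≠ Fin.succ (2 : Fin 3) := one_ne_three4
  have n23 : (2 : Fin 4) ≠ Fin.succ (2 : Fin 3) := two_ne_three4
  refine ⟨MvPolynomial.X ⟨1, ne_and_notMem_zero n13 one_ne_zero4⟩ *
    MvPolynomial.X ⟨2, ne_and_notMem_zero n23 two_ne_zero4⟩ + 1,
    ⟨1, ne_and_notMem_zero n13 one_ne_zero4⟩, ?_, ?_, ?_⟩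
  · have hGeq : G[(2 : Fin 3)] =
        chartGen cc (Fin.succ (2 : Fin 3)) 1 * chartGen cc (Fin.succ (2 : Fin 3)) 2 + 1 := by
      rw [show chartGen cc (Fin.succ (2 : Fin 3)) 3 = 1 from chartGen_self cc _]
      ring
    rw [map_add, map_mul, map_one, chartStageEquiv_X, chartStageEquiv_X, hGeq, map_add, map_mul,
      map_one]
  · rw [map_add, MvPolynomial.pderiv_one, add_zero, MvPolynomial.pderiv_mul,
      MvPolynomial.pderiv_X_self,
      MvPolynomial.pderiv_X_of_ne (fun h => one_ne_two4 (congrArg Subtype.val h).symm),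
      mul_zero, add_zero, one_mul]
    exact MvPolynomial.X_ne_zero _
  · intro Q hQ hGQ
    refine ⟨⟨1, ne_and_notMem_zero n13 one_ne_zero4⟩, ?_⟩
    rw [map_add, MvPolynomial.pderiv_one, add_zero, MvPolynomial.pderiv_mul,
      MvPolynomial.pderiv_X_self,
      MvPolynomial.pderiv_X_of_ne (fun h => one_ne_two4 (congrArg Subtype.val h).symm),
      mul_zero, add_zero, one_mul]
    intro h2
    apply hQ.ne_top ((Ideal.eq_top_iff_one Q).mpr ?_)
    have h3 := Q.sub_mem hGQ (Q.mul_mem_left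
      (MvPolynomial.X ⟨1, ne_and_notMem_zero n13 one_ne_zero4⟩) h2)
    rwa [add_sub_cancel_left] at h3

include hc in
/-- **The conic on the `v_k`-chart**: a polynomial `Ḡ` over `Λ = A/(c)` with `ε Ḡ = G mod
(w, u')`, some partial derivative of `Ḡ` non-zero, and the Jacobian criterion at every prime.
[folklore] -/
theorem exists_conic [Nontrivial Λ] (k : Fin 3) :
    ∃ (Gb : MvPolynomial σ[k] Λ) (m : σ[k]), ε[k] Gb = Ideal.Quotient.mk _ G[k] ∧
      MvPolynomial.pderiv m Gb ≠ 0 ∧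
      ∀ (Q : Ideal (MvPolynomial σ[k] Λ)), Q.IsPrime → Gb ∈ Q →
        ∃ m', MvPolynomial.pderiv m' Gb ∉ Q := by
  match k with
  | ⟨0, _⟩ => exact exists_conic_zero t v hc
  | ⟨1, _⟩ => exact exists_conic_one t v hc
  | ⟨2, _⟩ => exact exists_conic_two t v hc

/-! ### Discharging the hypotheses of the last step -/

include hc in
/-- **`G` is a non-zero-divisor modulo `(w, u')`** (`Ḡ ≠ 0` in the domain `Λ[T]`).
[folklore] -/
theorem mk_G_mem_nonZeroDivisors (k : Fin 3) [IsDomain (A ⧸ Ideal.span (Set.range cc))] :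
    Ideal.Quotient.mk (Ideal.span (Set.range c₃[k])) G[k] ∈
      nonZeroDivisors (chartRing cc (Fin.succ k) ⧸ Ideal.span (Set.range c₃[k])) := by
  haveI : IsDomain Λ := by rw [sup_bot_eq]; infer_instance
  obtain ⟨Gb, m, hGb, hm, -⟩ := exists_conic t v hc k
  have hGb0 : Gb ≠ 0 := fun h => hm (by rw [h, map_zero])
  have h1 := RingEquiv.map_mem_nonZeroDivisors ε[k] (mem_nonZeroDivisors_of_ne_zero hGb0)
  rw [hGb] at h1
  have h2 := RingEquiv.map_mem_nonZeroDivisors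
    (Ideal.quotEquivOfEq (chartStageIdeal_two_eq t v k)) h1
  rwa [Ideal.quotEquivOfEq_mk] at h2

include hc in
/-- **`C_j ⧸ (w, u', G)` is a regular ring** (the conic `Ḡ = 0` in `𝔸²_Λ` is regular: Jacobian
criterion). [cite: Matsumura1987, Thm. 14.2] -/
theorem isRegularRing_quot_cthree_sup_G (k : Fin 3) [IsDomain (A ⧸ Ideal.span (Set.range cc))]
    [IsRegularRing (A ⧸ Ideal.span (Set.range cc))] :
    IsRegularRing (chartRing cc (Fin.succ k) ⧸
      (Ideal.span (Set.range c₃[k]) ⊔ Ideal.span {G[k]})) := by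
  haveI : IsDomain Λ := by rw [sup_bot_eq]; infer_instance
  haveI : IsRegularRing Λ := by rw [sup_bot_eq]; infer_instance
  haveI : IsRegularRing (MvPolynomial σ[k] Λ) := MvPolynomial.isRegularRing_of_isRegularRing _
  obtain ⟨Gb, m, hGb, -, hJ⟩ := exists_conic t v hc k
  obtain ⟨eq, -⟩ := exists_quotient_equiv_sup_span _ ε[k] Gb G[k] hGb
  haveI := MvPolynomial.isRegularRing_quotient_span_of_pderiv hJ
  have e2 := eq.trans (Ideal.quotEquivOfEq
    (congrArg (· ⊔ Ideal.span {G[k]}) (chartStageIdeal_two_eq t v k)))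
  exact IsRegularRing.of_ringEquiv (R := MvPolynomial σ[k] Λ ⧸ Ideal.span {Gb}) e2

/-- **`C_j ⧸ (u', G)` is regular at every prime not containing `w`**, transported from
`A ⧸ (t, F)` at the primes not containing `v_k` through the common localisation
`C_j[1/w] = A[1/v_k]` (`(u', G) ↦ (t/v_k, F/v_k²)`). [cite: StacksProject, Tag 07Z3] -/
theorem isRegularLocalRing_quot_span_u'_G (k : Fin 3)
    (hreg1 : ∀ (P : Ideal (A ⧸ Ideal.span {t, F})) [P.IsPrime],
      Ideal.Quotient.mk (Ideal.span {t, F}) (v k) ∉ P → IsRegularLocalRing (Localization.AtPrime P))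
    (P : Ideal (chartRing cc (Fin.succ k) ⧸ Ideal.span {u'[k], G[k]})) [P.IsPrime]
    (hP : Ideal.Quotient.mk (Ideal.span {u'[k], G[k]}) w[k] ∉ P) :
    IsRegularLocalRing (Localization.AtPrime P) := by
  letI alg : Algebra (chartRing cc (Fin.succ k)) (Localization.Away (cc (Fin.succ k))) :=
    (reesChart (cc (Fin.succ k)) (Ideal.mem_span_range_self (f := cc) (x := Fin.succ k))).toAlgebra
  haveI hloc : IsLocalization.Away w[k] (Localization.Away (cc (Fin.succ k))) :=
    isLocalization_reesChart (cc (Fin.succ k))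
      (Ideal.mem_span_range_self (f := cc) (x := Fin.succ k))
  set inv := IsLocalization.Away.invSelf (S := Localization.Away (cc (Fin.succ k)))
    (cc (Fin.succ k)) with hinv
  have hunit : IsUnit inv :=
    IsUnit.of_mul_eq_one (algebraMap A (Localization.Away (cc (Fin.succ k))) (cc (Fin.succ k)))
      (by rw [mul_comm]; exact IsLocalization.Away.mul_invSelf (cc (Fin.succ k)))
  have hJ : (Ideal.span {u'[k], G[k]}).map (algebraMap (chartRing cc (Fin.succ k))
        (Localization.Away (cc (Fin.succ k))) : _ →+* Localization.Away (cc (Fin.succ k))) =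
      (Ideal.span {t, F}).map
        (algebraMap A (Localization.Away (cc (Fin.succ k))) :
          A →+* Localization.Away (cc (Fin.succ k))) := by
    rw [Ideal.map_span, Set.image_insert_eq, Set.image_singleton, Ideal.map_span,
      Set.image_insert_eq, Set.image_singleton, RingHom.algebraMap_toAlgebra, map_add, map_mul,
      map_pow, reesChart_chartGen, reesChart_chartGen, reesChart_chartGen, reesChart_chartGen]
    have e1 : algebraMap A (Localization.Away (cc (Fin.succ k))) (cc 1) * inv *
        (algebraMap A _ (cc 2) * inv) + (algebraMap A _ (cc 3) * inv) ^ 2 =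
        algebraMap A _ F * (inv * inv) := by
      change algebraMap A _ (v 0) * inv * (algebraMap A _ (v 1) * inv) +
        (algebraMap A _ (v 2) * inv) ^ 2 = _
      rw [map_add, map_mul, map_pow]
      ring
    rw [← hinv, e1, show cc 0 = t from rfl, Ideal.span_insert,
      Ideal.span_singleton_mul_right_unit hunit,
      Ideal.span_singleton_mul_right_unit (hunit.mul hunit), ← Ideal.span_insert]
  exact isRegularLocalRing_localization_quotient_of_notMem_of_away (cc (Fin.succ k)) w[k]
    (Ideal.span {t, F}) (Ideal.span {u'[k], G[k]}) hJ (fun P' _ hP' => hreg1 P' hP') P hP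

/-! ### The charts of `Bl_{z₀}` -/

include hc in
/-- **The `v_k`-chart of `Bl_{z₀}`: every blow-up of `Spec C_j` along `(𝔨 𝔴) C_j = w² (u', w G)
(w, u')` is regular** — twist off `w²`, blow up the plane `(w, u')` (chartwise assembly), then
the last step. [cite: Liu2002, Thm. 8.1.19 (a)] [cite: StacksProject, Tag 080A] -/
theorem isRegular_of_isBlowup_kw_succ (k : Fin 3) [IsRegularRing A]
    [IsRegularRing (A ⧸ Ideal.span (Set.range cc))] [IsDomain (A ⧸ Ideal.span (Set.range cc))]
    (hreg1 : ∀ (P : Ideal (A ⧸ Ideal.span {t, F})) [P.IsPrime],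
      Ideal.Quotient.mk (Ideal.span {t, F}) (v k) ∉ P → IsRegularLocalRing (Localization.AtPrime P))
    {Y : Scheme.{u}} {ρ : Y ⟶ Spec (.of (chartRing cc (Fin.succ k)))}
    (hρ : IsBlowup ρ (affineBlowup.idealSheaf
      ((Ideal.span {t, F} * (Ideal.span {v 0, v 1, v 2} ^ 2 ⊔ Ideal.span {t})).map
        (chartBase cc (Fin.succ k))))) :
    Scheme.IsRegular Y := by
  haveI : IsRegularRing (chartRing cc (Fin.succ k)) := isRegularRing_blowupChart cc (Fin.succ k) hc
  haveI := isRegularRing_quot_cthree t v hc k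
  haveI := isRegularRing_quot_cthree_sup_G t v hc k
  have hG := mk_G_mem_nonZeroDivisors t v hc k
  have hoff := isRegularLocalRing_quot_span_u'_G t v k hreg1
  have hc₃ := isQuasiRegular_cthree t v hc k
  rw [map_chartBase_kw_succ, ← span_range_cthree w[k] u'[k]] at hρ
  have hw2 : w[k] ^ 2 ∈ nonZeroDivisors (chartRing cc (Fin.succ k)) :=
    pow_mem (reesChartBase_mem_nonZeroDivisors (cc (Fin.succ k))
      (Ideal.mem_span_range_self (f := cc) (x := Fin.succ k))) 2
  exact isRegular_of_isBlowup_span_singleton_mul_of_forall hw2 _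
    (fun Y' ρ' h' => isRegular_of_isBlowup_mul_of_charts c₃[k] (Ideal.span {u'[k], w[k] * G[k]})
      (fun l Y'' ρ'' h'' => isRegular_of_isBlowup_map_J w[k] u'[k] G[k] hc₃ hG hoff l h'') h') hρ

include hc in
/-- **The `t`-chart of `Bl_{z₀}`: every blow-up of `Spec C₀` along `(𝔨 𝔴) C₀ = (w²)` is regular**
(an isomorphism onto the regular chart). [cite: Liu2002, Thm. 8.1.19 (a) (affine charts)] -/
theorem isRegular_of_isBlowup_kw_zero [IsRegularRing A]
    [IsRegularRing (A ⧸ Ideal.span (Set.range cc))]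
    {Y : Scheme.{u}} {ρ : Y ⟶ Spec (.of (chartRing cc 0))}
    (hρ : IsBlowup ρ (affineBlowup.idealSheaf
      ((Ideal.span {t, F} * (Ideal.span {v 0, v 1, v 2} ^ 2 ⊔ Ideal.span {t})).map
        (chartBase cc 0)))) :
    Scheme.IsRegular Y := by
  haveI : IsRegularRing (chartRing cc 0) := isRegularRing_blowupChart cc 0 hc
  rw [map_chartBase_kw_zero] at hρ
  exact isRegular_of_isBlowup_idealSheaf_span_singleton_of_isRegularRing
    (pow_mem (reesChartBase_mem_nonZeroDivisors (cc 0)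
      (Ideal.mem_span_range_self (f := cc) (x := 0))) 2) hρ

include hc in
/-- **LEVEL TWO: every blowing up of `Spec A` along `(𝔨 𝔴) · (t, v₀, v₁, v₂)` is regular** —
blow up `(t, v)` (chartwise assembly, Stacks 080A) and use the two chart statements.
[cite: StacksProject, Tag 080A] [cite: Liu2002, Thm. 8.1.19 (a)] -/
theorem isRegular_of_isBlowup_kw_mul_span [IsRegularRing A]
    [IsRegularRing (A ⧸ Ideal.span (Set.range cc))] [IsDomain (A ⧸ Ideal.span (Set.range cc))]
    (hreg1 : ∀ (k : Fin 3) (P : Ideal (A ⧸ Ideal.span {t, F})) [P.IsPrime],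
      Ideal.Quotient.mk (Ideal.span {t, F}) (v k) ∉ P → IsRegularLocalRing (Localization.AtPrime P))
    {Y : Scheme.{u}} {f : Y ⟶ Spec (.of A)}
    (hf : IsBlowup f (affineBlowup.idealSheaf
      ((Ideal.span {t, F} * (Ideal.span {v 0, v 1, v 2} ^ 2 ⊔ Ideal.span {t})) *
        Ideal.span (Set.range cc)))) :
    Scheme.IsRegular Y :=
  isRegular_of_isBlowup_mul_of_charts cc _
    (fun j => Fin.cases
      (motive := fun j => ∀ (Y : Scheme.{u}) (ρ : Y ⟶ Spec (.of (chartRing cc j))),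
        IsBlowup ρ (affineBlowup.idealSheaf
          ((Ideal.span {t, F} * (Ideal.span {v 0, v 1, v 2} ^ 2 ⊔ Ideal.span {t})).map
            (chartBase cc j))) → Scheme.IsRegular Y)
      (fun _ _ h => isRegular_of_isBlowup_kw_zero t v hc h)
      (fun k _ _ h => isRegular_of_isBlowup_kw_succ t v hc k (hreg1 k) h) j) hf

end Regular

end ConeRung

end Summit.ResolutionOfSingularities.ResolutionOfSingularities.Theorems

end
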